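/-
Copyright (c) 2026 the pub-hodgecm-mathlib formalisation cell (harness21).  Prover seat hodgecm-mathlib-R90-C131-p01 (g3), R90-TF section S6 «Ch. 14.1–14.5 stable trace
formula» (h413 = `stmt-HodgeConjecture-24833`), S6 dealer R90-C14-plan (g3) RULINGS #25 (R65) ∕ #32 (R75)(R76) card (T4-VAL-a) := (T4.7), FILE 2 of the three-file cut:
THE (T4.7) HEAD, HYPOTHESIS-FIRST on the non-split exclusion `hNS`.  THEOREMS ONLY (no `def`, no `instance`, no notation, no named-fact hypothesis, no `sorry`); ★-only imports,
NO `Lines` import, NO sheet import.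
-/
import Summits.HodgeConjecture.HodgeConjecture.Theorems.R90S6TwistedFirstShellSplitLayer   -- ★ (T4-VAL-a) FILE 1: `existsUnique_apartment_mem_twistedShell_one_zero_zero` (brings ★ (T4.4), ★ (T4-SYM), ★ `UnramifiedLocalConjDatum`)
import HarnessLib

/-!
# R90-TF · S6 «Ch. 14.1–14.5», (T4-VAL-a) FILE 2: THE FIRST-SHELL VALUE `#Shell(δ′, (1,0,0)) = 1` AT A WEIGHT-ONE TYPE-(1) CLASS, MODULO THE NON-SPLIT EXCLUSION `hNS`
# (Kottwitz 1986 §1 pp. 240–242, §3; typ2 (g3) D1-a memo 54c3d5da6c7c81b4 §0–§2, §6)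

Cell `hodgecm-mathlib`, crux H413 (`stmt-HodgeConjecture-24833`, lane `--supports … --as helper`), route of record `HCCMUnconditional` (no route verbs;
count-neutral).  Programme R90-TF, section S6, DAG row E1.4.4.2.2; S6 dealer R90-C14-plan (g3) (R75): «FILE 2 `R90S6TwistedFirstShellValueOneDepthZero` = (T4.7) :294 VERBATIM,
hypothesis-first on the ONE letter `hNS` («every first-shell member of a type-(1) depth-0 class lies in the eigenframe apartment», D1-a §1–§2 — `∃ n, x = mk (g * zpowDiagGL
hϖ.ne_zero n)`) → FILE 3 `R90S6TwistedFirstShellNoNonsplitDepthZero` = the `hNS` payer over ★ (T4-NS) + depth-0 rigidity».  SPEC AUTHORITY typ2 (g3) (SHEET v2.3 0f48cf5c7bade6f2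
§5 :294–:305 (T4.7) `ncard_twistedShell_one_zero_zero_eq_one_of_frame_of_depthZero`).

THE STATEMENT.  `ncard_twistedShell_one_zero_zero_eq_one_of_frame_of_depthZero_of_apartment` = the (T4.7) binder block BYTE FOR BYTE (residual letters `hσO σk hσk`, `[Fintype 𝓀[K]]
hq hfrob`, frame `hδ hu`, class `hc`, depth `hdepth`, weight-one parity `hodd hone`; conclusion `Shell(δ′, (1,0,0)).ncard = 1`) with TWO additions, both announced on the R90 bus
(04:07:55Z): the instance binder `[IsDiscreteValuationRing (ValuativeRel.valuation K).integer]` that every Cartan-uniqueness input needs (the sheet's §3∕§4 carry it, §5 does not),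
and the LAST explicit binder **`hNS`** = «every member of `Shell(δ′, (1,0,0))` is an apartment vertex `[g·ϖ^n]` of the eigenframe torus».  The letters `hσk hq hfrob hdepth` are not
consumed by this layer (they are what FILE 3 uses to PAY `hNS`: depth 0 = `hdepth`, the residual Frobenius for the graph equations `λ^{q+1} = −w̄₂∕w̄₁`); they ride as `_`-binders
so that the eventual unconditional (T4.7) is `… := …_of_apartment … (noNonsplit …)` with the sheet's argument list unchanged.
THE PROOF (8 lines over ★ FILE 1): the apartment carries EXACTLY ONE member `[g·ϖ^{n₀}]`, `n₀ = ⌊c∕2⌋` (★ `existsUnique_apartment_mem_twistedShell_one_zero_zero`: ★ (T4.4)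
eigenframe dictionary + the parity count), and by `hNS` every member is an apartment vertex, hence equal to it; `Set.ncard_eq_one`.
HONEST LABEL: HC_CM is proved only modulo the 7 printed citations (2 remaining named inputs: hLiu418 = stmt-HodgeConjecture-24832, h413 = stmt-HodgeConjecture-24833) until rung 0
closes; (T4.7) is proved here MODULO the named letter `hNS` (the non-split exclusion, D1-a §1–§2 — NOT proved in the tree tonight); count-neutral helper; REL ≠ ★ ≠ BUILT.

## References
* [Kottwitz1986BaseChangeUnits] R. E. Kottwitz, *Base change for unit elements of Hecke algebras*, Compositio Math. 60 (1986), §1 pp. 240–242, §3.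
* [Macdonald1995] I. G. Macdonald, *Symmetric Functions and Hall Polynomials*, 2nd ed. (1995), Ch. V §2 (2.6).
* [Rogawski1990] J. D. Rogawski, *Automorphic Representations of Unitary Groups in Three Variables*, Ann. of Math. Stud. 123 (1990), §4.10 pp. 57–58.
-/

set_option autoImplicit false
-- the mandated namespace repeats the single-problem summit's segment (`HodgeConjecture.HodgeConjecture`)
set_option linter.dupNamespace false

noncomputable section

open scoped Valued WithZero Matrix MatrixGroups Pointwise
open Literature.NumberTheory.Automorphic Literature.NumberTheory.Automorphic.HermitianLattice Literature.NumberTheory.Automorphic.UnitaryLatticeTree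

namespace Summit.HodgeConjecture.HodgeConjecture.R90.S6

section Values

variable {K : Type} [Field K] [Valued K ℤᵐ⁰] [ValuativeRel K] [(Valued.v : Valuation K ℤᵐ⁰).Compatible] {σ : K →+* K} {ϖ : K}
  (hϖ : IsUniformizingElement ϖ)

/-- **(T4.7) MODULO THE NON-SPLIT EXCLUSION: WEIGHT-ONE CLASSES HAVE EXACTLY ONE FIRST-SHELL LATTICE** (SHEET v2.3 §5 :294 binder block byte for byte, + the DVR instance binder,
+ the last letter `hNS`).  TYPE (1), DEPTH 0 (`hdepth`), an orthogonal eigenframe `g` of `δ′` (`g⁻¹δ′g = diag(d)`, `ᵗ(σg)·J₀·g = diag(u)`) with `v(d_i) = v(u_i·ϖ^{c_i})` and exactly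
one odd `c_i` (`Σc` odd, not all odd): IF every member of `Shell(δ′, (1,0,0))` is an apartment vertex `[g·ϖ^n]` (`hNS` — D1-a §1–§2: a non-split member would have hull∕core gap of
`(1,1,0)`- or `(1,1,1)`-type by the depth-0 rigidity `M ∩ γ⁻¹M ∩ γ⁻²M = 0`, and each such graph fails `τΛ ⊂ Λ`), THEN `#Shell(δ′, (1,0,0)) = 1`, the member being `[g·ϖ^{⌊c∕2⌋}]`
(★ FILE 1 `existsUnique_apartment_mem_twistedShell_one_zero_zero`).  The residual letters `hσk hq hfrob` and `hdepth` are FILE 3's inputs for paying `hNS`; unused here.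
[cite: Kottwitz1986BaseChangeUnits, §1 pp. 240–242, §3] [cite: Macdonald1995, Ch. V §2 (2.6)] -/
theorem ncard_twistedShell_one_zero_zero_eq_one_of_frame_of_depthZero_of_apartment [IsDiscreteValuationRing (ValuativeRel.valuation K).integer]
    (hd : UnramifiedLocalConjDatum σ ϖ)
    (hσO : ∀ x : 𝒪[K], σ x ∈ 𝒪[K]) (σk : 𝓀[K] →+* 𝓀[K]) (_hσk : ∀ x : 𝒪[K], IsLocalRing.residue 𝒪[K] ⟨σ x, hσO x⟩ = σk (IsLocalRing.residue 𝒪[K] x))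
    [Fintype 𝓀[K]] {q : ℕ} (_hq : Fintype.card 𝓀[K] = q ^ 2) (_hfrob : ∀ y, σk y = y ^ q)
    {g δ' : GL (Fin 3) K} {d u : Fin 3 → Kˣ} {c : Fin 3 → ℤ}
    (hδ : g⁻¹ * δ' * g = diagonalGL (Fin 3) K d)
    (hu : formCongr σ g ((StdForm.antidiagonal 3).over K) = Matrix.diagonal fun i => (u i : K))
    (hc : ∀ i, Valued.v (d i : K) = Valued.v ((u i : K) * ϖ ^ c i))
    (_hdepth : ∀ i j, i ≠ j → Valued.v ((d i : K) * σ (d j : K) - (d j : K) * σ (d i : K)) = Valued.v ((d i : K) * (d j : K)))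
    (hodd : Odd (c 0 + c 1 + c 2)) (hone : ¬ (Odd (c 0) ∧ Odd (c 1) ∧ Odd (c 2)))
    (hNS : ∀ x ∈ {x : GL (Fin 3) K ⧸ glInt 3 K |
        x.out⁻¹ * δ' * UnitaryGroup.qsInvolution σ x.out ∈
          (glInt 3 K : Set (GL (Fin 3) K)) * {zpowDiagGL hϖ.ne_zero ![1, 0, 0]} * (glInt 3 K : Set (GL (Fin 3) K))},
      ∃ n : Fin 3 → ℤ, x = ((g * zpowDiagGL hϖ.ne_zero n : GL (Fin 3) K) : GL (Fin 3) K ⧸ glInt 3 K)) :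
    {x : GL (Fin 3) K ⧸ glInt 3 K |
      x.out⁻¹ * δ' * UnitaryGroup.qsInvolution σ x.out ∈
        (glInt 3 K : Set (GL (Fin 3) K)) * {zpowDiagGL hϖ.ne_zero ![1, 0, 0]} * (glInt 3 K : Set (GL (Fin 3) K))}.ncard = 1 := by
  obtain ⟨n₀, hn₀, huniq⟩ := existsUnique_apartment_mem_twistedShell_one_zero_zero hϖ hd hδ hu hc hodd hone
  rw [Set.ncard_eq_one]
  refine ⟨((g * zpowDiagGL hϖ.ne_zero n₀ : GL (Fin 3) K) : GL (Fin 3) K ⧸ glInt 3 K), Set.eq_singleton_iff_unique_mem.2 ⟨hn₀, fun x hx => ?_⟩⟩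
  obtain ⟨n, rfl⟩ := hNS x hx
  rw [huniq n hx]

end Values

end Summit.HodgeConjecture.HodgeConjecture.R90.S6

end
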